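import Summits.Ventures.PercRepro.MSTightNoExtra

/-!
# The no-extra lemma and the slack count on a ground set ((F1), (F2) of Addendum 37, ground form)

Dossier proofs/MINE1-theoremS.md, Addendum 37 (F1), (F2), (F5), and proofs/MINE1-RSTARM-PROOF.md
§0–§1. The tree's `not_sig_ao_of_tight_of_diffs_eq_faces`, `card_faces_eq_succ` and
`mem_of_compl_mem_of_exists_subset` (MSTightNoExtra.lean) state the no-extra lemma and the slack
count for instances on the whole finite type (`univ ∖ y ∈ L'`). The instances produced by (F5) —
the projection along an outside vertex and the restriction to `u` — live on a SMALLER ground set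
`S` (`S.erase m`, resp. `u`), with complements taken inside `S`. This module restates the three
results with an explicit ground set `S : Finset α`: every member of `T` lies inside `S`, `S ∖ y ∈ L'`
for every member, and `u ⊆ S`. The proofs are those of MSTightNoExtra.lean with `univ` replaced by
`S` (Theorem S in its down-closed form `exists_downSet_upSet_of_tight_of_isDownSet` already takes
the ground set as a parameter).
-/

namespace PercRepro.MSTight

open Finset
open scoped FinsetFamily

variable {α : Type*} [DecidableEq α]

/-- Two unions of a set disjoint from `M` and a set inside `M` agree iff their parts agree. -/
theorem parts_eq_of_union_eq_of_disjoint {M x x' z z' : Finset α} (hx : Disjoint x M)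
    (hx' : Disjoint x' M) (hz : z ⊆ M) (hz' : z' ⊆ M) (h : x ∪ z = x' ∪ z') :
    x = x' ∧ z = z' := by
  constructor
  · have e1 : (x ∪ z) \ M = x := by
      rw [union_sdiff_distrib, sdiff_eq_self_of_disjoint hx, sdiff_eq_empty_iff_subset.2 hz,
        union_empty]
    have e2 : (x' ∪ z') \ M = x' := by
      rw [union_sdiff_distrib, sdiff_eq_self_of_disjoint hx', sdiff_eq_empty_iff_subset.2 hz',
        union_empty]
    rw [← e1, ← e2, h]
  · have e1 : (x ∪ z) ∩ M = z := by
      rw [union_inter_distrib_right, (disjoint_iff_inter_eq_empty.1 hx), empty_union,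
        inter_eq_left.2 hz]
    have e2 : (x' ∪ z') ∩ M = z' := by
      rw [union_inter_distrib_right, (disjoint_iff_inter_eq_empty.1 hx'), empty_union,
        inter_eq_left.2 hz']
    rw [← e1, ← e2, h]

/-- A set inside `S \ M` is disjoint from `M`. -/
theorem disjoint_of_subset_sdiff {S M x : Finset α} (hx : x ⊆ S \ M) : Disjoint x M :=
  disjoint_of_subset_left hx disjoint_sdiff_self_left

/-- **The no-extra lemma on a ground set `S`.** A tight nonempty family `F` of subsets of `S`
whose differences are exactly the members of a down-set `L'` below a member, with `S ∖ t ∈ L'` for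
every member, admits no `u ⊆ S`, `u ∉ L'`, satisfying (Sig) together with an A-only set (AO). -/
theorem not_sig_ao_of_tight_of_diffs_eq_faces_ground {S : Finset α} {L' F : Finset (Finset α)}
    (hdown : ∀ w ∈ L', ∀ w', w' ⊆ w → w' ∈ L')
    (hF : Tight F) (hne : F.Nonempty) (hFS : ∀ t ∈ F, t ⊆ S) (hFU : ∀ t ∈ F, S \ t ∈ L')
    (hnoextra : F \\ F = L'.filter fun w => ∃ y ∈ F, w ⊆ y)
    (u : Finset α) (huS : u ⊆ S) (hu : u ∉ L')
    (hsig : ∀ v ∈ L', v ⊆ u → u \ v ∈ L' ∨ ∃ y ∈ F, v ⊆ y)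
    (hao : ∃ v₀ ∈ L', v₀ ⊆ u ∧ u \ v₀ ∈ L' ∧ ∀ y ∈ F, ¬ v₀ ⊆ y) : False := by
  obtain ⟨v₀, hv₀, hv₀u, -, hv₀F⟩ := hao
  -- the differences form a down-set: Theorem S in its down-closed form
  have hD : IsDownSet (F \\ F) := by
    rw [hnoextra]; exact isDownSet_filter_exists_subset hdown
  obtain ⟨M, -, L, U, hL, hLN, hU, hUM, hFLU, hDLU⟩ :=
    exists_downSet_upSet_of_tight_of_isDownSet hF hD hFS
  -- `L` and `U` are nonempty, so `∅ ∈ L` and `M ∈ U`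
  have hLne : L.Nonempty := by
    obtain ⟨t, ht⟩ := hne
    rw [hFLU] at ht
    obtain ⟨x, hx, -, -, -⟩ := mem_sups.1 ht
    exact ⟨x, hx⟩
  have hUne : U.Nonempty := by
    obtain ⟨t, ht⟩ := hne
    rw [hFLU] at ht
    obtain ⟨-, -, z, hz, -⟩ := mem_sups.1 ht
    exact ⟨z, hz⟩
  have hemptyL : (∅ : Finset α) ∈ L := by
    obtain ⟨x, hx⟩ := hLne
    exact hL x hx ∅ (empty_subset _)
  have hMU : M ∈ U := by
    obtain ⟨z, hz⟩ := hUne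
    exact hU z hz M (subset_refl _) (hUM z hz)
  have hMF : M ∈ F := by
    rw [hFLU]; exact mem_sups.2 ⟨∅, hemptyL, M, hMU, by simp⟩
  -- `u` meets every member, in particular every member of `U`
  have hmeet : ∀ t ∈ F, ¬ Disjoint u t := by
    intro t ht hdis
    apply hu
    exact hdown _ (hFU t ht) u (subset_sdiff.2 ⟨huS, hdis⟩)
  have hUmem : ∀ z ∈ U, z ∈ F := by
    intro z hz
    rw [hFLU]; exact mem_sups.2 ⟨∅, hemptyL, z, hz, by simp⟩
  -- `u ∩ M` is not the complement within `M` of a member of `U`, hence not in `L'`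
  have huM : u ∩ M ∉ complWithin M U := by
    intro h
    obtain ⟨z, hz, hzeq⟩ := mem_complWithin.1 h
    apply hmeet z (hUmem z hz)
    rw [disjoint_iff_inter_eq_empty]
    have hzM : z ⊆ M := hUM z hz
    have : u ∩ z = (u ∩ M) ∩ z := by rw [inter_assoc, inter_eq_right.2 hzM]
    rw [this, ← hzeq, inter_comm]
    exact inter_sdiff_self z M
  have huML : u ∩ M ∉ L' := by
    intro h
    have hface : u ∩ M ∈ F \\ F := by
      rw [hnoextra, mem_filter]
      exact ⟨h, M, hMF, inter_subset_right⟩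
    rw [hDLU] at hface
    obtain ⟨x, hx, z', hz', hxz⟩ := mem_sups.1 hface
    have hz'M : z' ⊆ M := by
      obtain ⟨z, -, rfl⟩ := mem_complWithin.1 hz'
      exact sdiff_subset
    have hxz' : x ∪ z' = ∅ ∪ (u ∩ M) := by simpa using hxz
    obtain ⟨-, hz'eq⟩ := parts_eq_of_union_eq_of_disjoint (disjoint_of_subset_sdiff (hLN x hx))
      (disjoint_empty_left M) hz'M inter_subset_right hxz'
    rw [← hz'eq] at huM
    exact huM hz'
  -- (Sig) at `u ∖ M` makes it a face, hence a member of `L`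
  have huNL' : u \ M ∈ L' :=
    hdown _ (hFU M hMF) _ (sdiff_subset_sdiff huS (subset_refl _))
  have huNL : u \ M ∈ L := by
    rcases hsig _ huNL' sdiff_subset with h | ⟨y, hy, hsub⟩
    · exact absurd (by simpa [sdiff_sdiff_right_self] using h) huML
    · have hface : u \ M ∈ F \\ F := by
        rw [hnoextra, mem_filter]; exact ⟨huNL', y, hy, hsub⟩
      rw [hDLU] at hface
      obtain ⟨x, hx, z', hz', hxz⟩ := mem_sups.1 hface
      have hz'M : z' ⊆ M := by
        obtain ⟨z, -, rfl⟩ := mem_complWithin.1 hz'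
        exact sdiff_subset
      have hxz' : x ∪ z' = (u \ M) ∪ ∅ := by simpa using hxz
      obtain ⟨hxeq, -⟩ := parts_eq_of_union_eq_of_disjoint (disjoint_of_subset_sdiff (hLN x hx))
        disjoint_sdiff_self_left hz'M (empty_subset _) hxz'
      rw [← hxeq]; exact hx
  -- `v₀ ∖ M ∈ L`, so `v₀ ⊆ (v₀ ∖ M) ∪ M ∈ F` — against (AO)
  have hv₀L : v₀ \ M ∈ L := hL _ huNL _ (sdiff_subset_sdiff hv₀u (subset_refl _))
  have hmem : (v₀ \ M) ∪ M ∈ F := by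
    rw [hFLU]; exact mem_sups.2 ⟨_, hv₀L, M, hMU, rfl⟩
  exact hv₀F _ hmem (by intro a ha; by_cases haM : a ∈ M <;> simp [ha, haM])

/-- The differences of a family of subsets of `S` whose `S`-complements lie in the down-set `L'`
are faces. -/
theorem diffs_subset_faces_ground {S : Finset α} {L' T : Finset (Finset α)}
    (hdown : ∀ w ∈ L', ∀ w', w' ⊆ w → w' ∈ L') (hTS : ∀ y ∈ T, y ⊆ S)
    (hTU : ∀ y ∈ T, S \ y ∈ L') :
    T \\ T ⊆ (L'.filter fun w => ∃ y ∈ T, w ⊆ y) := by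
  intro d hd
  obtain ⟨y, hy, y', hy', rfl⟩ := mem_diffs.1 hd
  exact mem_filter.2 ⟨hdown _ (hTU y' hy') _ (sdiff_subset_sdiff (hTS y hy) (subset_refl y')),
    y, hy, sdiff_subset⟩

/-- On a ground set `S`: under (Sig) + (AO), `|faces| ≤ |T|` is impossible. -/
theorem not_card_faces_le_ground {S : Finset α} {L' T : Finset (Finset α)}
    (hdown : ∀ w ∈ L', ∀ w', w' ⊆ w → w' ∈ L')
    (hne : T.Nonempty) (hTS : ∀ y ∈ T, y ⊆ S) (hTU : ∀ y ∈ T, S \ y ∈ L')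
    (u : Finset α) (huS : u ⊆ S) (hu : u ∉ L')
    (hsig : ∀ v ∈ L', v ⊆ u → u \ v ∈ L' ∨ ∃ y ∈ T, v ⊆ y)
    (hao : ∃ v₀ ∈ L', v₀ ⊆ u ∧ u \ v₀ ∈ L' ∧ ∀ y ∈ T, ¬ v₀ ⊆ y)
    (hle : ((L'.filter fun w => ∃ y ∈ T, w ⊆ y)).card ≤ T.card) : False := by
  have h1 : T.card ≤ (T \\ T).card := card_le_card_diffs T
  have h2 : (T \\ T).card ≤ ((L'.filter fun w => ∃ y ∈ T, w ⊆ y)).card :=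
    card_le_card (diffs_subset_faces_ground hdown hTS hTU)
  have hF : Tight T := by
    unfold Tight; omega
  have hnoextra : T \\ T = (L'.filter fun w => ∃ y ∈ T, w ⊆ y) :=
    eq_of_subset_of_card_le (diffs_subset_faces_ground hdown hTS hTU) (by omega)
  exact not_sig_ao_of_tight_of_diffs_eq_faces_ground hdown hF hne hTS hTU hnoextra u huS hu hsig hao

/-- **(F2) on a ground set: the slack is exactly one.** -/
theorem card_faces_eq_succ_ground {S : Finset α} {L' T : Finset (Finset α)}
    (hdown : ∀ w ∈ L', ∀ w', w' ⊆ w → w' ∈ L')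
    (hne : T.Nonempty) (hTS : ∀ y ∈ T, y ⊆ S) (hTU : ∀ y ∈ T, S \ y ∈ L')
    (hcnt : ((L'.filter fun w => ∃ y ∈ T, w ⊆ y)).card ≤ T.card + 1)
    (u : Finset α) (huS : u ⊆ S) (hu : u ∉ L')
    (hsig : ∀ v ∈ L', v ⊆ u → u \ v ∈ L' ∨ ∃ y ∈ T, v ⊆ y)
    (hao : ∃ v₀ ∈ L', v₀ ⊆ u ∧ u \ v₀ ∈ L' ∧ ∀ y ∈ T, ¬ v₀ ⊆ y) :
    ((L'.filter fun w => ∃ y ∈ T, w ⊆ y)).card = T.card + 1 := by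
  by_contra h
  exact not_card_faces_le_ground hdown hne hTS hTU u huS hu hsig hao (by omega)

/-- **(F2) on a ground set: `T = U ∩ ↓T`.** Every `z ⊆ S` with `S ∖ z ∈ L'` lying below a member
of `T` is a member of `T`. -/
theorem mem_of_compl_mem_of_exists_subset_ground {S : Finset α} {L' T : Finset (Finset α)}
    (hdown : ∀ w ∈ L', ∀ w', w' ⊆ w → w' ∈ L')
    (hTS : ∀ y ∈ T, y ⊆ S) (hTU : ∀ y ∈ T, S \ y ∈ L')
    (hcnt : ((L'.filter fun w => ∃ y ∈ T, w ⊆ y)).card ≤ T.card + 1)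
    (u : Finset α) (huS : u ⊆ S) (hu : u ∉ L')
    (hsig : ∀ v ∈ L', v ⊆ u → u \ v ∈ L' ∨ ∃ y ∈ T, v ⊆ y)
    (hao : ∃ v₀ ∈ L', v₀ ⊆ u ∧ u \ v₀ ∈ L' ∧ ∀ y ∈ T, ¬ v₀ ⊆ y)
    {z : Finset α} (hzS : z ⊆ S) (hz : S \ z ∈ L') (hzT : ∃ y ∈ T, z ⊆ y) : z ∈ T := by
  by_contra hzn
  have hfaces : (L'.filter fun w => ∃ y ∈ insert z T, w ⊆ y) =
      (L'.filter fun w => ∃ y ∈ T, w ⊆ y) := faces_insert_of_subset_mem hzT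
  have hne' : (insert z T).Nonempty := insert_nonempty z T
  have hTS' : ∀ y ∈ insert z T, y ⊆ S := by
    intro y hy
    rw [mem_insert] at hy
    rcases hy with rfl | hy
    · exact hzS
    · exact hTS y hy
  have hTU' : ∀ y ∈ insert z T, S \ y ∈ L' := by
    intro y hy
    rw [mem_insert] at hy
    rcases hy with rfl | hy
    · exact hz
    · exact hTU y hy
  have hsig' : ∀ v ∈ L', v ⊆ u → u \ v ∈ L' ∨ ∃ y ∈ insert z T, v ⊆ y := by
    intro v hv hvu
    rcases hsig v hv hvu with h | ⟨y, hy, hvy⟩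
    · exact Or.inl h
    · exact Or.inr ⟨y, mem_insert_of_mem hy, hvy⟩
  have hao' : ∃ v₀ ∈ L', v₀ ⊆ u ∧ u \ v₀ ∈ L' ∧ ∀ y ∈ insert z T, ¬ v₀ ⊆ y := by
    obtain ⟨v₀, hv₀, hv₀u, hv₀c, hv₀T⟩ := hao
    refine ⟨v₀, hv₀, hv₀u, hv₀c, ?_⟩
    intro y hy hsub
    rw [mem_insert] at hy
    rcases hy with rfl | hy
    · obtain ⟨y', hy', hzy'⟩ := hzT
      exact hv₀T y' hy' (hsub.trans hzy')
    · exact hv₀T y hy hsub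
  have hcard : (insert z T).card = T.card + 1 := card_insert_of_notMem hzn
  exact not_card_faces_le_ground hdown hne' hTS' hTU' u huS hu hsig' hao'
    (by rw [hfaces, hcard]; exact hcnt)

end PercRepro.MSTight
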